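import Summits.MatrixMultiplication.OmegaCensus.C2QuaternionLaw
import Summits.MatrixMultiplication.OmegaCensus.C2DihedralLowerBound
import HarnessLib

/-!
# `β(C₂^k × Q_{4m}) = 2^k · β(Q_{4m}) = 2^k · 16m/3` for every `k` and every `m ≡ 0 (mod 3)`

ω-census, family (b3).  Framing: lottery ticket; floor = certified bounds/negative ranges.

`C₂^k × Q_{4m} = G(𝔽₂^k × ℤ_{2m}, (0, m))` is of dicyclic type (`c2pow_quaternion_presentation`, the elementary abelian factor is
central because `−v = v`), `|A| = 2^k · 2m`.  When `3 ∣ m` the general dihedral-like law `3V ≤ 8|A|` is attained by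
`(C₂^k, 1, 1) ×` an optimal triple of `Q_{4m}` (`quaternion_volume_ge_law`), so **`c2pow_quaternion_law`:
β(C₂^k × Q_{4m}) = 2^k · 16m/3** uniformly in `k` (e.g. `β(C₂^k × Q₁₂) = 2^{k+4}`, `β(C₂^k × Q₂₄) = 2^{k+5}`).
For `3 ∤ m` the answer depends on `k`: exact for `k ≤ 3` in the cases of `c2_quaternion_law_ge_three`, `c2c2_quaternion_law_ge_two`,
`c2c2c2_quaternion_law`; the product lower bound `2^k β(Q_{4m})` meets the structural upper bound only there.
-/

namespace Summit.MatrixMultiplication.OmegaCensus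

open Literature.Combinatorics.Additive Finset
open Summit.MatrixMultiplication.MatrixMultiplication.Theorems.JuntaBranch.Planting (tpp_product)

section C2PowQ

variable {k m : ℕ} [NeZero m]

omit [NeZero m] in
/-- The presentation of `C₂^k × Q_{4m}` as `G(𝔽₂^k × ℤ_{2m}, (0, m))`, packaged. [folklore] -/
theorem c2pow_quaternion_presentation
    {P : Prop}
    (K : ∀ (ρ τ : (Fin k → ZMod 2) × ZMod (2 * m) → Multiplicative (Fin k → ZMod 2) × QuaternionGroup m)
      (c₀ : (Fin k → ZMod 2) × ZMod (2 * m)),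
      (∀ a b, ρ a * ρ b = ρ (a + b)) → (∀ a b, ρ a * τ b = τ (b - a)) → (∀ a b, τ a * ρ b = τ (a + b)) →
      (∀ a b, τ a * τ b = ρ (c₀ + b - a)) → Function.Injective ρ → Function.Injective τ → (∀ a b, ρ a ≠ τ b) →
      (∀ g, (∃ a, ρ a = g) ∨ (∃ a, τ a = g)) → c₀ = ((0 : Fin k → ZMod 2), (m : ZMod (2 * m))) → P) : P := by
  have hneg : ∀ v : Fin k → ZMod 2, -v = v := fun v => funext fun i => ZMod.neg_eq_self_mod_two (v i)
  exact K (fun p => (Multiplicative.ofAdd p.1, QuaternionGroup.a p.2))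
    (fun p => (Multiplicative.ofAdd p.1, QuaternionGroup.xa p.2)) ((0 : Fin k → ZMod 2), (m : ZMod (2 * m)))
    (fun a b => by
      simp only [Prod.mk_mul_mk, QuaternionGroup.a_mul_a, ← ofAdd_add, Prod.fst_add, Prod.snd_add])
    (fun a b => by
      simp only [Prod.mk_mul_mk, QuaternionGroup.a_mul_xa, ← ofAdd_add, Prod.fst_sub, Prod.snd_sub]
      rw [sub_eq_add_neg b.1, hneg, add_comm b.1])
    (fun a b => by
      simp only [Prod.mk_mul_mk, QuaternionGroup.xa_mul_a, ← ofAdd_add, Prod.fst_add, Prod.snd_add])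
    (fun a b => by
      simp only [Prod.mk_mul_mk, QuaternionGroup.xa_mul_xa, ← ofAdd_add, Prod.fst_sub, Prod.snd_sub, Prod.fst_add,
        Prod.snd_add, zero_add]
      rw [sub_eq_add_neg b.1, hneg, add_comm b.1])
    (fun a b hab => by
      simp only [Prod.mk.injEq, QuaternionGroup.a.injEq] at hab
      exact Prod.ext (Multiplicative.ofAdd.injective hab.1) hab.2)
    (fun a b hab => by
      simp only [Prod.mk.injEq, QuaternionGroup.xa.injEq] at hab
      exact Prod.ext (Multiplicative.ofAdd.injective hab.1) hab.2)
    (fun a b hab => by simp at hab)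
    (fun g => by
      obtain ⟨i, q⟩ := g
      cases q with
      | a j => exact Or.inl ⟨(Multiplicative.toAdd i, j), rfl⟩
      | xa j => exact Or.inr ⟨(Multiplicative.toAdd i, j), rfl⟩)
    rfl

/-- **Upper bound** (general law): `|S||T||U| ≤ 2^k · 16m/3` in `C₂^k × Q_{4m}` when `3 ∣ m`. [folklore] -/
theorem c2pow_quaternion_tpp_volume_le (h3 : 3 ∣ m)
    {S T U : Finset (Multiplicative (Fin k → ZMod 2) × QuaternionGroup m)} (h : TripleProductProperty S T U) :
    S.card * T.card * U.card ≤ 2 ^ k * (16 * m / 3) := by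
  haveI : NeZero (2 * m) := ⟨by have := NeZero.ne m; omega⟩
  refine c2pow_quaternion_presentation (k := k) (m := m) fun ρ τ c₀ hρρ hρτ hτρ hττ hρ hτ hne hsurj _ => ?_
  have key := tpp_volume_le_of_dihedralLike hρρ hρτ hτρ hττ hρ hτ hne hsurj h
  have hcard : Fintype.card ((Fin k → ZMod 2) × ZMod (2 * m)) = 2 ^ k * (2 * m) := by
    rw [Fintype.card_prod, Fintype.card_fun, ZMod.card, ZMod.card, Fintype.card_fin]
  rw [hcard] at key
  obtain ⟨q, rfl⟩ := h3
  have e : 16 * (3 * q) / 3 = 16 * q := by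
    rw [show 16 * (3 * q) = 3 * (16 * q) by ring, Nat.mul_div_cancel_left _ (by norm_num)]
  rw [e]
  have key' : 3 * (S.card * T.card * U.card) ≤ 3 * (2 ^ k * (16 * q)) := by
    calc 3 * (S.card * T.card * U.card) ≤ 8 * (2 ^ k * (2 * (3 * q))) := key
      _ = 3 * (2 ^ k * (16 * q)) := by ring
  exact Nat.le_of_mul_le_mul_left key' (by norm_num)

/-- **Lower bound**: `(C₂^k, 1, 1) ×` an optimal triple of `Q_{4m}` (`m ≥ 3`, `3 ∣ m`). [folklore] -/
theorem c2pow_quaternion_volume_ge (hm : 3 ≤ m) (h3 : 3 ∣ m) :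
    ∃ S T U : Finset (Multiplicative (Fin k → ZMod 2) × QuaternionGroup m), TripleProductProperty S T U ∧
      S.card * T.card * U.card = 2 ^ k * (16 * m / 3) := by
  obtain ⟨S, T, U, h, hvol⟩ := quaternion_volume_ge_law (n := m) hm
  refine ⟨univ ×ˢ S, {1} ×ˢ T, {1} ×ˢ U, tpp_product tpp_univ_one_one h, ?_⟩
  rw [card_product, card_product, card_product, card_univ, card_singleton, Fintype.card_multiplicative,
    Fintype.card_fun, ZMod.card, Fintype.card_fin]
  have e : 2 ^ k * S.card * (1 * T.card) * (1 * U.card) = 2 ^ k * (S.card * T.card * U.card) := by ring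
  rw [e, hvol]
  obtain ⟨q, rfl⟩ := h3
  rw [show 2 * (3 * q) = 3 * (2 * q) by ring, show 16 * (3 * q) = 3 * (16 * q) by ring,
    Nat.mul_div_cancel_left _ (by norm_num), Nat.mul_div_cancel_left _ (by norm_num)]
  ring

/-- **`β(C₂^k × Q_{4m}) = 2^k · 16m/3 = 2^k β(Q_{4m})` for every `k` and every `m ≥ 3` with `3 ∣ m`** (kernel).
[folklore] -/
theorem c2pow_quaternion_law (hm : 3 ≤ m) (h3 : 3 ∣ m) :
    (∀ S T U : Finset (Multiplicative (Fin k → ZMod 2) × QuaternionGroup m), TripleProductProperty S T U →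
        S.card * T.card * U.card ≤ 2 ^ k * (16 * m / 3)) ∧
    ∃ S T U : Finset (Multiplicative (Fin k → ZMod 2) × QuaternionGroup m), TripleProductProperty S T U ∧
      S.card * T.card * U.card = 2 ^ k * (16 * m / 3) :=
  ⟨fun _ _ _ h => c2pow_quaternion_tpp_volume_le h3 h, c2pow_quaternion_volume_ge hm h3⟩

end C2PowQ

end Summit.MatrixMultiplication.OmegaCensus
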